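import Summits.ValiantsHypothesis.ValiantsHypothesis.Theorems.DefinabilityGapZperTransferRO
import HarnessLib

/-!
# DefinabilityGap — the RATIO NORMAL FORM of full width-2 read-once hitting (kernel)

Route `route-ValiantsHypothesis-DefinabilityGap`, read-once leaf F4 / W10 (`KIPlantedHittingRO`,
stmt-ValiantsHypothesis-23704).

The transfer of record (`DefinabilityGapZperTransferRO.chainVal_eq_zero_of_bind₁_kiPer_ro`) derives FULL width-2
read-once hitting of `φ = bind₁ (kiPer m)` from the chart leaf `ZperHitsRO(m)`, which is only SUFFICIENT and lives in
`K[Y]`, `K = Frac ℂ[y]`. This file replaces it by an INTRINSIC leaf which is EQUIVALENT to full width 2.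

Write a width-2 read-once block chain as `L :: rest`, `L = (c, M)`, and let `G₀, G₁ ∈ ℂ[z]` be the two column values
of the suffix `rest` (`chainVal_cons_mat`: `value = A(z_c)·G₀ + B(z_c)·G₁`, `(A, B) = uᵀM`). Dividing out
`gcd(A, B)` — harmless under `φ` because `g(P_c) ≠ 0` for `g ≠ 0` (`aeval_kiPer_ne_zero`) — the induction on the
length consumes exactly

  `RatioLeaf(m)`: for every block `c`, every read-once suffix `rest` not reading `c` (blocks pairwise distinct), every
  output vector `v` and every COPRIME pair `(A, B)` of univariates, not both constant,
  `A(P_c)·φ(G₀) + B(P_c)·φ(G₁) = 0 ⟹ φ(G₀) = φ(G₁) = 0`,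

i.e. «the `φ`-images of the two columns of a read-once width-2 chain avoiding `c` are never in a non-constant ratio
`-B(P_c) : A(P_c)` from `ℂ(P_c)`»:

* `chainVal_eq_zero_of_ratioLeaf` — **FULL WIDTH 2 ⟸ `RatioLeaf(m)`** (`m ≥ 1`; KERNEL);
* `ratioLeaf_of_hits` — **`RatioLeaf(m)` ⟸ FULL WIDTH 2** (prepend the link `(c, [[A, B],[0,0]])`; the `φ`-free
  relation `A(z_c)G₀ + B(z_c)G₁ = 0` with `z_c ∉ G₀, G₁` forces `G₀ = G₁ = 0`, `pair_eq_zero_of_rel`, by the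
  substitutions `z_c ↦ λ`);
* `ratioLeaf_iff` — the equivalence; `kiPer_hits_isROABP_two_of_ratioLeaf` — the `KIPlantedHittingRO` currency
  (`w = 2`, every `d`, `π`, `N`);
* `exists_cofactor` — the H-FORM of a violation: `φ(G₀) = -B(P_c)·H`, `φ(G₁) = A(P_c)·H`.

So deciding full width 2 of 23704's matrix at `m` IS deciding `RatioLeaf(m)`; with `DefinabilityGapWidthTwoAtTwo`
(width-2 read-once hitting fails at `m = 2`) `RatioLeaf(2)` is false, and the open range is `m ≥ 3`.
WHAT THE LEAF IS NOT: it is not the chain-free field statement `ℂ(P_c) ∩ ℂ(P_U) = ℂ` (`U` = the other blocks), which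
is false as soon as `P_c` is algebraic over `ℂ(P_U)`; the read-once chain structure of `(G₀, G₁)` is load-bearing.
HONEST GRADE: a reformulation (equivalence), not progress on `m ≥ 3`; not a rung.
Helper of stmt-23704; 0 S-currency; rung 0; `VP ≠ VNP` untouched. [cite: SahaSaptharishiSaxena2009, Lemma 2.1]
[cite: KabanetsImpagliazzo2003, Lemma 30]
-/

open MvPolynomial Finset
open scoped Polynomial
open Literature.Computability.AlgebraicComplexity Literature.Computability.MetaComplexity

namespace Summit.ValiantsHypothesis.ValiantsHypothesis.Theorems.DefinabilityGapRatioLeaf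

open DefinabilityGapAffineRung DefinabilityGapAxisSubstitution DefinabilityGapZperTransfer DefinabilityGapZperTransferRO

noncomputable section

variable {m : ℕ}

/-! ## 1. The two columns of a width-2 chain -/

/-- Column `k` of the row vector `uᵀM`: the univariate `Σ_i u_i · M_{ik}`. [this file] -/
def rowPoly (M : Matrix (Fin 2) (Fin 2) ℂ[X]) (u : Fin 2 → ℂ) (k : Fin 2) : ℂ[X] :=
  ∑ i, Polynomial.C (u i) * M i k

/-- The link `(c, [[A, B], [0, 0]])`. [this file] -/
def abLink (c : Fin 3 → Fin (qOf m)) (A B : ℂ[X]) : W2Link m := ⟨c, !![A, B; 0, 0]⟩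

/-- Its block. [this file] -/
theorem abLink_blk (c : Fin 3 → Fin (qOf m)) (A B : ℂ[X]) : (abLink c A B).blk = c := rfl

/-- Its first column against `(1, 0)`. [this file] -/
theorem rowPoly_abLink_zero (c : Fin 3 → Fin (qOf m)) (A B : ℂ[X]) : rowPoly (abLink c A B).M ![1, 0] 0 = A := by
  simp [rowPoly, abLink, Fin.sum_univ_two]

/-- Its second column against `(1, 0)`. [this file] -/
theorem rowPoly_abLink_one (c : Fin 3 → Fin (qOf m)) (A B : ℂ[X]) : rowPoly (abLink c A B).M ![1, 0] 1 = B := by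
  simp [rowPoly, abLink, Fin.sum_univ_two]

/-- The column values: `chainVal l e_k v = (∏ l · v)_k`. [this file] -/
theorem chainVal_single {σ R : Type*} [CommSemiring R] (l : List (Matrix (Fin 2) (Fin 2) (MvPolynomial σ R)))
    (k : Fin 2) (v : Fin 2 → R) : chainVal l (Pi.single k 1) v = (l.prod.mulVec fun j => C (v j)) k := by
  rw [chainVal, Fintype.sum_eq_single k fun i hi => by rw [Pi.single_eq_of_ne hi, C_0, zero_mul]]
  rw [Pi.single_eq_same, C_1, one_mul]

/-- Linearity in the input vector: `value(u) = u₀ · G₀ + u₁ · G₁`. [this file] -/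
theorem chainVal_eq_lin {σ R : Type*} [CommSemiring R] (l : List (Matrix (Fin 2) (Fin 2) (MvPolynomial σ R)))
    (u v : Fin 2 → R) :
    chainVal l u v = C (u 0) * chainVal l (Pi.single 0 1) v + C (u 1) * chainVal l (Pi.single 1 1) v := by
  rw [chainVal_single, chainVal_single, chainVal, Fin.sum_univ_two]

/-- **COLUMN DECOMPOSITION**: `value(L :: rest) = A(z_c)·G₀ + B(z_c)·G₁` with `(A, B) = uᵀM` the two columns of
the head link and `G₀, G₁` the column values of the suffix. [this file] -/
theorem chainVal_cons_mat (L : W2Link m) (rest : List (W2Link m)) (u v : Fin 2 → ℂ) :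
    chainVal ((L :: rest).map W2Link.mat) u v =
      uni L.blk (rowPoly L.M u 0) * chainVal (rest.map W2Link.mat) (Pi.single 0 1) v +
        uni L.blk (rowPoly L.M u 1) * chainVal (rest.map W2Link.mat) (Pi.single 1 1) v := by
  rw [chainVal_single, chainVal_single, List.map_cons, chainVal, List.prod_cons, ← Matrix.mulVec_mulVec]
  generalize (rest.map W2Link.mat).prod.mulVec (fun j => C (v j)) = W
  simp only [Matrix.mulVec, dotProduct, Fin.sum_univ_two, rowPoly, uni, map_add, map_mul, Polynomial.aeval_C,
    MvPolynomial.algebraMap_eq, W2Link.mat, ulink, Matrix.map_apply]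
  ring

/-- The column decomposition under `φ`: `φ(value) = A(P_c)·φ(G₀) + B(P_c)·φ(G₁)`. [this file] -/
theorem bind₁_chainVal_cons_mat (L : W2Link m) (rest : List (W2Link m)) (u v : Fin 2 → ℂ) :
    bind₁ (kiPer m) (chainVal ((L :: rest).map W2Link.mat) u v) =
      Polynomial.aeval (kiPer m L.blk) (rowPoly L.M u 0) * bind₁ (kiPer m) (chainVal (rest.map W2Link.mat) (Pi.single 0 1) v) +
        Polynomial.aeval (kiPer m L.blk) (rowPoly L.M u 1) *
          bind₁ (kiPer m) (chainVal (rest.map W2Link.mat) (Pi.single 1 1) v) := by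
  rw [chainVal_cons_mat, map_add, map_mul, map_mul, bind₁_uni, bind₁_uni]

/-- A read-once chain reads only its blocks. [this file] -/
theorem chainVal_mem_supported (rest : List (W2Link m)) (u v : Fin 2 → ℂ) :
    chainVal (rest.map W2Link.mat) u v ∈ supported ℂ {b | b ∈ rest.map W2Link.blk} := by
  induction rest generalizing u with
  | nil =>
    rw [List.map_nil, List.map_nil, chainVal_nil, mem_supported, vars_C, Finset.coe_empty]
    exact Set.empty_subset _
  | cons L rest ih =>
    rw [chainVal_cons_mat]
    have hsub : supported ℂ {b | b ∈ rest.map W2Link.blk} ≤ supported ℂ {b | b ∈ (L :: rest).map W2Link.blk} :=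
      supported_mono fun b hb => by
        simp only [Set.mem_setOf_eq, List.map_cons, List.mem_cons] at hb ⊢
        exact Or.inr hb
    have hL : L.blk ∈ {b | b ∈ (L :: rest).map W2Link.blk} := by simp
    exact add_mem (mul_mem (uni_mem_supported hL _) (hsub (ih _))) (mul_mem (uni_mem_supported hL _) (hsub (ih _)))

/-- A block not read by the chain is not a variable of its value. [this file] -/
theorem not_mem_vars_chainVal {c : Fin 3 → Fin (qOf m)} {rest : List (W2Link m)} (hc : c ∉ rest.map W2Link.blk)
    (u v : Fin 2 → ℂ) : c ∉ (chainVal (rest.map W2Link.mat) u v).vars := fun h =>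
  hc (mem_supported.1 (chainVal_mem_supported rest u v) (Finset.mem_coe.2 h))

/-- `g(P_c) ≠ 0` for `g ≠ 0` (`m ≥ 1`): `P_c` is transcendental (axis substitution `ψ_c(P_c) = X`). [this file] -/
theorem aeval_kiPer_ne_zero (hm : 1 ≤ m) (c : Fin 3 → Fin (qOf m)) {g : ℂ[X]} (hg : g ≠ 0) :
    Polynomial.aeval (kiPer m c) g ≠ 0 := fun h => by
  have h1 := congrArg (axisHom m c ⟨0, hm⟩) h
  rw [← Polynomial.aeval_algHom_apply, axisHom_kiPer_self, Polynomial.aeval_X_left_apply, map_zero] at h1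
  exact hg h1

/-! ## 2. The `φ`-free relation: `A(z_c)G₀ + B(z_c)G₁ = 0` forces `G₀ = G₁ = 0` -/

/-- The substitution `z_c ↦ t`, the other block variables fixed. [this file] -/
def evalAt (c : Fin 3 → Fin (qOf m)) (t : ℂ) : (Fin 3 → Fin (qOf m)) → MvPolynomial (Fin 3 → Fin (qOf m)) ℂ :=
  fun b => if b = c then C t else X b

/-- `evalAt` at `c`. [this file] -/
theorem evalAt_self (c : Fin 3 → Fin (qOf m)) (t : ℂ) : evalAt c t c = C t := by simp [evalAt]

/-- `evalAt` off `c`. [this file] -/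
theorem evalAt_ne {c b : Fin 3 → Fin (qOf m)} (h : b ≠ c) (t : ℂ) : evalAt c t b = X b := by simp [evalAt, h]

/-- `z_c ↦ t` fixes polynomials not reading `z_c`. [this file] -/
theorem aeval_evalAt_of_not_mem_vars (c : Fin 3 → Fin (qOf m)) (t : ℂ) {G : MvPolynomial (Fin 3 → Fin (qOf m)) ℂ}
    (hG : c ∉ G.vars) : aeval (evalAt c t) G = G := by
  have h := hom_congr_vars (f₁ := (aeval (evalAt c t) : MvPolynomial _ ℂ →ₐ[ℂ] MvPolynomial _ ℂ).toRingHom)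
    (f₂ := RingHom.id _) (p₁ := G) (p₂ := G) (RingHom.ext fun r => by simp)
    (fun i hi _ => by
      have hic : i ≠ c := fun e => hG (e ▸ hi)
      simp [evalAt_ne hic])
    rfl
  simpa using h

/-- `z_c ↦ t` sends `p(z_c)` to the constant `p(t)`. [this file] -/
theorem aeval_evalAt_uni (c : Fin 3 → Fin (qOf m)) (t : ℂ) (p : ℂ[X]) : aeval (evalAt c t) (uni c p) = C (p.eval t) := by
  rw [uni, ← Polynomial.aeval_algHom_apply, aeval_X, evalAt_self]
  exact Polynomial.aeval_algebraMap_apply_eq_algebraMap_eval t p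

/-- **THE `φ`-FREE RELATION**: if `A(z_c)·G₀ + B(z_c)·G₁ = 0` with `A, B` coprime, not both constant, and `G₀, G₁`
not reading `z_c`, then `G₀ = G₁ = 0`. [this file] -/
theorem pair_eq_zero_of_rel (c : Fin 3 → Fin (qOf m)) {A B : ℂ[X]} (hcop : IsCoprime A B)
    (hdeg : 0 < A.natDegree ∨ 0 < B.natDegree) {G₀ G₁ : MvPolynomial (Fin 3 → Fin (qOf m)) ℂ}
    (h₀ : c ∉ G₀.vars) (h₁ : c ∉ G₁.vars) (hrel : uni c A * G₀ + uni c B * G₁ = 0) : G₀ = 0 ∧ G₁ = 0 := by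
  have hev : ∀ t : ℂ, C (A.eval t) * G₀ + C (B.eval t) * G₁ = 0 := fun t => by
    have := congrArg (aeval (evalAt c t)) hrel
    rwa [map_add, map_mul, map_mul, aeval_evalAt_uni, aeval_evalAt_uni, aeval_evalAt_of_not_mem_vars c t h₀,
      aeval_evalAt_of_not_mem_vars c t h₁, map_zero] at this
  have hB : B ≠ 0 := by
    rintro rfl
    have h1 := Polynomial.natDegree_eq_zero_of_isUnit (isCoprime_zero_right.1 hcop)
    simp [h1] at hdeg
  obtain ⟨μ, hμ⟩ : ∃ μ : ℂ, B.eval μ ≠ 0 := by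
    by_contra hall
    push Not at hall
    exact hB (Polynomial.funext fun r => by rw [hall r, Polynomial.eval_zero])
  have hG₀ : G₀ = 0 := by
    by_contra hG₀
    have h2 : C (B.eval μ)⁻¹ * C (B.eval μ) = (1 : MvPolynomial (Fin 3 → Fin (qOf m)) ℂ) := by
      rw [← C_mul, inv_mul_cancel₀ hμ, C_1]
    have hG₁ : G₁ = -(C (A.eval μ) * C (B.eval μ)⁻¹) * G₀ := by
      linear_combination (C (B.eval μ)⁻¹) * hev μ + (-G₁) * h2
    have hid : ∀ t : ℂ, A.eval t - B.eval t * (A.eval μ * (B.eval μ)⁻¹) = 0 := fun t => by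
      have h4 := hev t
      rw [hG₁] at h4
      have h3 : C (A.eval t - B.eval t * (A.eval μ * (B.eval μ)⁻¹)) * G₀ = 0 := by
        rw [map_sub, map_mul, map_mul]
        linear_combination h4
      exact C_eq_zero.1 ((mul_eq_zero.1 h3).resolve_right hG₀)
    have hpoly : A = B * Polynomial.C (A.eval μ * (B.eval μ)⁻¹) := by
      refine Polynomial.funext fun t => ?_
      rw [Polynomial.eval_mul, Polynomial.eval_C]
      exact sub_eq_zero.1 (hid t)
    have hunit : IsUnit B := hcop.isUnit_of_dvd' ⟨_, hpoly⟩ (dvd_refl B)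
    have hB0 := Polynomial.natDegree_eq_zero_of_isUnit hunit
    have hA0 : A.natDegree = 0 := by
      have := Polynomial.natDegree_mul_C_le B (A.eval μ * (B.eval μ)⁻¹)
      rw [← hpoly] at this
      omega
    omega
  refine ⟨hG₀, ?_⟩
  have h5 := hev μ
  rw [hG₀, mul_zero, zero_add] at h5
  exact (mul_eq_zero.1 h5).resolve_left fun h => hμ (C_eq_zero.1 h)

/-! ## 3. FULL width 2 ⟺ `RatioLeaf(m)` -/

/-- **FULL WIDTH 2 FROM THE RATIO LEAF** (KERNEL, `m ≥ 1`): if for every block `c`, every read-once suffix `rest`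
not reading `c`, every `v` and every coprime, not-both-constant pair `(A, B)` the relation
`A(P_c)·φ(G₀) + B(P_c)·φ(G₁) = 0` forces `φ(G₀) = φ(G₁) = 0` (hypothesis `hRL` = `RatioLeaf(m)`), then
`φ = bind₁ (kiPer m)` annihilates no nonzero width-2 read-once block chain. Induction on the length: column
decomposition, `gcd(A, B)` divided out (`g(P_c) ≠ 0`), constant columns absorbed into the input vector. [this file] -/
theorem chainVal_eq_zero_of_ratioLeaf (hm : 1 ≤ m)
    (hRL : ∀ (c : Fin 3 → Fin (qOf m)) (rest : List (W2Link m)), (rest.map W2Link.blk).Nodup →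
      c ∉ rest.map W2Link.blk → ∀ (v : Fin 2 → ℂ) (A B : ℂ[X]), IsCoprime A B → (0 < A.natDegree ∨ 0 < B.natDegree) →
      Polynomial.aeval (kiPer m c) A * bind₁ (kiPer m) (chainVal (rest.map W2Link.mat) (Pi.single 0 1) v) +
          Polynomial.aeval (kiPer m c) B * bind₁ (kiPer m) (chainVal (rest.map W2Link.mat) (Pi.single 1 1) v) = 0 →
        bind₁ (kiPer m) (chainVal (rest.map W2Link.mat) (Pi.single 0 1) v) = 0 ∧
          bind₁ (kiPer m) (chainVal (rest.map W2Link.mat) (Pi.single 1 1) v) = 0) :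
    ∀ l : List (W2Link m), (l.map W2Link.blk).Nodup → ∀ u v : Fin 2 → ℂ,
      bind₁ (kiPer m) (chainVal (l.map W2Link.mat) u v) = 0 → chainVal (l.map W2Link.mat) u v = 0 := by
  intro l
  induction l with
  | nil =>
    intro _ u v h
    rw [List.map_nil, chainVal_nil] at h ⊢
    rw [bind₁_C_right, C_eq_zero] at h
    rw [h, C_0]
  | cons L rest ih =>
    intro hnd u v h
    rw [List.map_cons, List.nodup_cons] at hnd
    obtain ⟨hc, hnd'⟩ := hnd
    rw [bind₁_chainVal_cons_mat] at h
    rw [chainVal_cons_mat]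
    generalize rowPoly L.M u 0 = A at h ⊢
    generalize rowPoly L.M u 1 = B at h ⊢
    by_cases hAB : A = 0 ∧ B = 0
    · rw [hAB.1, hAB.2, uni_zero, zero_mul, zero_mul, add_zero]
    classical
    have hg : EuclideanDomain.gcd A B ≠ 0 := fun h0 => hAB (EuclideanDomain.gcd_eq_zero_iff.1 h0)
    have hgl := EuclideanDomain.gcd_dvd_left A B
    have hgr := EuclideanDomain.gcd_dvd_right A B
    have hbez := EuclideanDomain.gcd_eq_gcd_ab A B
    generalize EuclideanDomain.gcd A B = g at hg hgl hgr hbez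
    obtain ⟨A', hA'⟩ := hgl
    obtain ⟨B', hB'⟩ := hgr
    have hcop : IsCoprime A' B' := by
      refine ⟨EuclideanDomain.gcdA A B, EuclideanDomain.gcdB A B, mul_left_cancel₀ hg ?_⟩
      rw [mul_one]
      calc g * (EuclideanDomain.gcdA A B * A' + EuclideanDomain.gcdB A B * B')
          = g * A' * EuclideanDomain.gcdA A B + g * B' * EuclideanDomain.gcdB A B := by ring
        _ = A * EuclideanDomain.gcdA A B + B * EuclideanDomain.gcdB A B := by rw [← hA', ← hB']
        _ = g := hbez.symm
    have hgP : Polynomial.aeval (kiPer m L.blk) g ≠ 0 := aeval_kiPer_ne_zero hm _ hg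
    have h' : Polynomial.aeval (kiPer m L.blk) A' * bind₁ (kiPer m) (chainVal (rest.map W2Link.mat) (Pi.single 0 1) v) +
        Polynomial.aeval (kiPer m L.blk) B' * bind₁ (kiPer m) (chainVal (rest.map W2Link.mat) (Pi.single 1 1) v) = 0 := by
      rw [hA', hB', map_mul, map_mul, mul_assoc, mul_assoc, ← mul_add] at h
      exact (mul_eq_zero.1 h).resolve_left hgP
    rw [hA', hB', uni_mul, uni_mul, mul_assoc, mul_assoc, ← mul_add]
    suffices hkey : uni L.blk A' * chainVal (rest.map W2Link.mat) (Pi.single 0 1) v +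
        uni L.blk B' * chainVal (rest.map W2Link.mat) (Pi.single 1 1) v = 0 by
      rw [hkey, mul_zero]
    by_cases hdeg : A'.natDegree = 0 ∧ B'.natDegree = 0
    · -- both columns constant: absorb them into the input vector and use the induction hypothesis
      obtain ⟨a, ha⟩ : ∃ a, A' = Polynomial.C a := ⟨_, Polynomial.eq_C_of_natDegree_eq_zero hdeg.1⟩
      obtain ⟨b, hb⟩ : ∃ b, B' = Polynomial.C b := ⟨_, Polynomial.eq_C_of_natDegree_eq_zero hdeg.2⟩
      rw [ha, hb] at h' ⊢
      rw [Polynomial.aeval_C, Polynomial.aeval_C, MvPolynomial.algebraMap_eq] at h'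
      rw [uni_C, uni_C]
      have key := ih hnd' ![a, b] v (by
        rw [chainVal_eq_lin, map_add, map_mul, map_mul, bind₁_C_right, bind₁_C_right]
        simpa using h')
      rw [chainVal_eq_lin] at key
      simpa using key
    · -- the ratio leaf
      have hdeg' : 0 < A'.natDegree ∨ 0 < B'.natDegree := by omega
      obtain ⟨h0, h1⟩ := hRL L.blk rest hnd' hc v A' B' hcop hdeg' h'
      rw [ih hnd' _ v h0, ih hnd' _ v h1, mul_zero, mul_zero, add_zero]

/-- **THE RATIO LEAF FROM FULL WIDTH 2**: conversely, width-2 read-once hitting implies `RatioLeaf(m)` — prepend the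
link `(c, [[A, B], [0, 0]])` and read the `φ`-free relation. [this file] -/
theorem ratioLeaf_of_hits
    (hH : ∀ l : List (W2Link m), (l.map W2Link.blk).Nodup → ∀ u v : Fin 2 → ℂ,
      bind₁ (kiPer m) (chainVal (l.map W2Link.mat) u v) = 0 → chainVal (l.map W2Link.mat) u v = 0) :
    ∀ (c : Fin 3 → Fin (qOf m)) (rest : List (W2Link m)), (rest.map W2Link.blk).Nodup →
      c ∉ rest.map W2Link.blk → ∀ (v : Fin 2 → ℂ) (A B : ℂ[X]), IsCoprime A B → (0 < A.natDegree ∨ 0 < B.natDegree) →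
      Polynomial.aeval (kiPer m c) A * bind₁ (kiPer m) (chainVal (rest.map W2Link.mat) (Pi.single 0 1) v) +
          Polynomial.aeval (kiPer m c) B * bind₁ (kiPer m) (chainVal (rest.map W2Link.mat) (Pi.single 1 1) v) = 0 →
        bind₁ (kiPer m) (chainVal (rest.map W2Link.mat) (Pi.single 0 1) v) = 0 ∧
          bind₁ (kiPer m) (chainVal (rest.map W2Link.mat) (Pi.single 1 1) v) = 0 := by
  intro c rest hnd hc v A B hcop hdeg h
  have hnd' : ((abLink c A B :: rest).map W2Link.blk).Nodup := by
    rw [List.map_cons, List.nodup_cons, abLink_blk]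
    exact ⟨hc, hnd⟩
  have hφ : bind₁ (kiPer m) (chainVal ((abLink c A B :: rest).map W2Link.mat) ![1, 0] v) = 0 := by
    rw [bind₁_chainVal_cons_mat, rowPoly_abLink_zero, rowPoly_abLink_one, abLink_blk]
    exact h
  have hrel := hH _ hnd' _ _ hφ
  rw [chainVal_cons_mat, rowPoly_abLink_zero, rowPoly_abLink_one, abLink_blk] at hrel
  obtain ⟨hG0, hG1⟩ :=
    pair_eq_zero_of_rel c hcop hdeg (not_mem_vars_chainVal hc _ _) (not_mem_vars_chainVal hc _ _) hrel
  rw [hG0, hG1, map_zero]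
  exact ⟨rfl, rfl⟩

/-- **FULL WIDTH-2 READ-ONCE HITTING ⟺ `RatioLeaf(m)`** (`m ≥ 1`): the intrinsic normal form of the leaf. [this file] -/
theorem ratioLeaf_iff (hm : 1 ≤ m) :
    (∀ (c : Fin 3 → Fin (qOf m)) (rest : List (W2Link m)), (rest.map W2Link.blk).Nodup →
      c ∉ rest.map W2Link.blk → ∀ (v : Fin 2 → ℂ) (A B : ℂ[X]), IsCoprime A B → (0 < A.natDegree ∨ 0 < B.natDegree) →
      Polynomial.aeval (kiPer m c) A * bind₁ (kiPer m) (chainVal (rest.map W2Link.mat) (Pi.single 0 1) v) +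
          Polynomial.aeval (kiPer m c) B * bind₁ (kiPer m) (chainVal (rest.map W2Link.mat) (Pi.single 1 1) v) = 0 →
        bind₁ (kiPer m) (chainVal (rest.map W2Link.mat) (Pi.single 0 1) v) = 0 ∧
          bind₁ (kiPer m) (chainVal (rest.map W2Link.mat) (Pi.single 1 1) v) = 0) ↔
    (∀ l : List (W2Link m), (l.map W2Link.blk).Nodup → ∀ u v : Fin 2 → ℂ,
      bind₁ (kiPer m) (chainVal (l.map W2Link.mat) u v) = 0 → chainVal (l.map W2Link.mat) u v = 0) :=
  ⟨chainVal_eq_zero_of_ratioLeaf hm, ratioLeaf_of_hits⟩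

/-- **FULL WIDTH 2 OF `KIPlantedHittingRO` FROM `RatioLeaf(m)`** (`w = 2`, every degree `d`, every variable order
`π`, every length `N`). [this file] -/
theorem kiPer_hits_isROABP_two_of_ratioLeaf (hm : 1 ≤ m)
    (hRL : ∀ (c : Fin 3 → Fin (qOf m)) (rest : List (W2Link m)), (rest.map W2Link.blk).Nodup →
      c ∉ rest.map W2Link.blk → ∀ (v : Fin 2 → ℂ) (A B : ℂ[X]), IsCoprime A B → (0 < A.natDegree ∨ 0 < B.natDegree) →
      Polynomial.aeval (kiPer m c) A * bind₁ (kiPer m) (chainVal (rest.map W2Link.mat) (Pi.single 0 1) v) +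
          Polynomial.aeval (kiPer m c) B * bind₁ (kiPer m) (chainVal (rest.map W2Link.mat) (Pi.single 1 1) v) = 0 →
        bind₁ (kiPer m) (chainVal (rest.map W2Link.mat) (Pi.single 0 1) v) = 0 ∧
          bind₁ (kiPer m) (chainVal (rest.map W2Link.mat) (Pi.single 1 1) v) = 0)
    {N d : ℕ} (π : Fin N ≃ (Fin 3 → Fin (qOf m))) (D : MvPolynomial (Fin 3 → Fin (qOf m)) ℂ) (hD : D ≠ 0)
    (hR : IsROABP ℂ 2 d π D) : bind₁ (kiPer m) D ≠ 0 := by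
  obtain ⟨hw, M, hM, hDM⟩ := hR
  choose p hp using hM
  let lk : Fin N → W2Link m := fun i => ⟨π i, Matrix.of fun a b => p i a b⟩
  have hmat : ∀ i, (lk i).mat = M i := fun i => by
    refine Matrix.ext fun a b => ?_
    simp only [W2Link.mat, ulink, Matrix.map_apply, Matrix.of_apply, lk]
    exact (hp i a b).2.symm
  have hl : (List.ofFn lk).map W2Link.mat = List.ofFn M := by
    rw [List.map_ofFn]
    exact congrArg List.ofFn (funext hmat)
  have hnd : ((List.ofFn lk).map W2Link.blk).Nodup := by
    rw [List.map_ofFn]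
    exact List.nodup_ofFn_ofInjective π.injective
  have hDval : D = chainVal ((List.ofFn lk).map W2Link.mat) ![1, 0] ![1, 0] := by
    rw [hl, hDM, chainVal]
    simp [Matrix.mulVec, dotProduct, Fin.sum_univ_two]
  intro h0
  apply hD
  rw [hDval] at h0 ⊢
  exact chainVal_eq_zero_of_ratioLeaf hm hRL _ hnd _ _ h0

/-! ## 4. The H-form of a violation -/

/-- **THE H-FORM**: a relation `A(P_c)·F₀ + B(P_c)·F₁ = 0` with `A, B` coprime (`m ≥ 1`) means
`F₀ = -B(P_c)·H`, `F₁ = A(P_c)·H` for one polynomial `H` — so a violation of `RatioLeaf(m)` is a read-once pair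
whose `φ`-images share a cofactor `H` up to the univariate multipliers `-B(P_c)`, `A(P_c)`. [this file] -/
theorem exists_cofactor (hm : 1 ≤ m) (c : Fin 3 → Fin (qOf m)) {A B : ℂ[X]} (hcop : IsCoprime A B)
    {F₀ F₁ : MvPolynomial (Fin (qOf m) × Fin (qOf m)) ℂ}
    (h : Polynomial.aeval (kiPer m c) A * F₀ + Polynomial.aeval (kiPer m c) B * F₁ = 0) :
    ∃ H, F₀ = -(Polynomial.aeval (kiPer m c) B) * H ∧ F₁ = Polynomial.aeval (kiPer m c) A * H := by
  by_cases hA : A = 0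
  · subst hA
    obtain ⟨b, hbu, rfl⟩ := Polynomial.isUnit_iff.1 (isCoprime_zero_left.1 hcop)
    have hb : b ≠ 0 := hbu.ne_zero
    rw [map_zero, zero_mul, zero_add, Polynomial.aeval_C, MvPolynomial.algebraMap_eq] at h
    have hF₁ : F₁ = 0 := (mul_eq_zero.1 h).resolve_left fun h' => hb (C_eq_zero.1 h')
    refine ⟨-(C b⁻¹ * F₀), ?_, by rw [hF₁, map_zero, zero_mul]⟩
    rw [Polynomial.aeval_C, MvPolynomial.algebraMap_eq, neg_mul_neg, ← mul_assoc, ← C_mul, mul_inv_cancel₀ hb, C_1,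
      one_mul]
  · have hcop' : IsCoprime (Polynomial.aeval (kiPer m c) A) (Polynomial.aeval (kiPer m c) B) := by
      simpa using hcop.map (Polynomial.aeval (kiPer m c)).toRingHom
    have hdvd : Polynomial.aeval (kiPer m c) A ∣ Polynomial.aeval (kiPer m c) B * F₁ :=
      ⟨-F₀, by linear_combination h⟩
    obtain ⟨H, hH⟩ := hcop'.dvd_of_dvd_mul_left hdvd
    refine ⟨H, mul_left_cancel₀ (aeval_kiPer_ne_zero hm c hA) ?_, hH⟩
    rw [hH] at h
    linear_combination h

end

end Summit.ValiantsHypothesis.ValiantsHypothesis.Theorems.DefinabilityGapRatioLeaf
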